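import Mathlib
import Summits.PneNP.PneNP.Theorems.OverlapGapAlgebraSearchHardWindowScanStep

/-!
# Route OverlapGapAlgebra, crux `SearchHardWindow` (stmt-PneNP-2460): a correlation inequality for
# the systematic-scan resampling walk (success AND stability, union-bound free) — part 3, assembly

Abstract setting of `…ScanWalk.lean` / `…ScanStep.lean`: symbols `S`, coordinates `J`, schedule
`σ : Fin T → J`, the coordinate-resampling walk `pos v U t` on `J → S`, a set of GOOD points `G`
(`InG`) and a symmetric reflexive STABILITY relation `St`.

**Theorem (`scc_count`).** With `N = |S|`, `V = J → S`, `p = #G/#V`,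
`#{(v, U) : all T+1 positions good ∧ all T steps stable} ≥ #V · N^T · p^{T+1} · exp(−(1/#G)·Σ_t Λ(σ t))`
where the DEFECT of direction `j` is `Λ(j) = Σ_{v ∈ G} (u_j(v)+1)/d_j(v) · log(u_j(v)+1)`,
`d_j(v) = #{s : v[j↦s] ∈ G}` (good points on the `j`-fibre), `u_j(v) = #{s : v[j↦s] ∈ G, ¬St(v, v[j↦s])}`
(unstable good fibre-neighbours); and (`scc_defect_le`) `Λ(j) ≤ 2 log(2N) · √(#V/N) · √U_j`,
`U_j = #{(v,s) : v ∈ G, v[j↦s] ∈ G, ¬St(v, v[j↦s])}`. Without stability (`Λ = 0`) this is the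
tight-path Sidorenko-type bound `P[Y_0, …, Y_T ∈ G] ≥ P[G]^{T+1}` for the systematic scan — a
union-bound free, doubling-free substitute for Huang–Sellke's correlation inequality
(arXiv:2501.06427 Lemma 3.1, which needs a reversible, time-homogeneous ensemble) valid for the
INHOMOGENEOUS Bresler–Huang path (arXiv:2106.02129 Def. 4.2).

Proof: geometric-mean potential `Σ_{v∈G} log q_T(v)` (`q_T(v)` = fraction of good-and-stable symbol
sequences from `v`), `scc_main`; the fibre sizes enter through `Σ_{v∈G} log d_j(v) ≥ #G·log(pN)`;
a final Jensen over `G`. The defect bound: `(u+1) log(u+1) ≤ 2u·log(2N)`, Cauchy–Schwarz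
`Σ_G u/d ≤ √(Σ_G u)·√(Σ_G u/d²)`, and `Σ_G u/d² ≤ Σ_G 1/d ≤ #V/N`. No definitions.
-/

set_option linter.dupNamespace false -- `Summit.PneNP.PneNP.…`: summit = sub-problem (D-0017)

namespace Summit.PneNP.PneNP.Theorems

open Finset
open scoped Classical

section ScanCorrelation

variable {S J : Type*} [DecidableEq J]

/-! ### The correlation inequality and the defect bound -/

/-- **The correlation inequality for the systematic scan, counting form.** For symbols `S`
(`|S| = N ≥ 1`), coordinates `J`, schedule `σ : Fin T → J`, a good set `G = {InG}` (nonempty,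
density `p = #G/N^{|J|}`), a symmetric reflexive stability relation `St` and the resampling walk
`pos` (`hpos0`, `hposS`): the pairs `(v, U)` whose walk stays in `G` at all `T+1` times and makes only
stable steps number at least `N^{|J|} · N^T · p^{T+1} · exp(−(1/#G) Σ_t Λ(σ t))`, where
`Λ(j) = Σ_{v∈G} (u_j(v)+1)/d_j(v) · log(u_j(v)+1)`, `d_j(v) = #{s : v[j↦s] ∈ G}`,
`u_j(v) = #{s : v[j↦s] ∈ G, ¬St(v, v[j↦s])}`. In probability language:
`P[walk good and stable throughout] ≥ p^{T+1} e^{−ΣΛ/#G}` — no union bound over the `T` steps. -/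
theorem scc_count [Fintype S] [Fintype J] [DecidableEq S] (hS : 0 < Fintype.card S)
    (T : ℕ) (σ : Fin T → J) (InG : (J → S) → Prop) (St : (J → S) → (J → S) → Prop)
    (hsymm : ∀ v w, St v w → St w v) (hrefl : ∀ v, St v v)
    (pos : (J → S) → (Fin T → S) → ℕ → (J → S)) (hpos0 : ∀ v U, pos v U 0 = v)
    (hposS : ∀ v U (t : Fin T), pos v U ((t : ℕ) + 1) = Function.update (pos v U t) (σ t) (U t))
    (hG : 0 < ((univ : Finset (J → S)).filter InG).card) :
    (Fintype.card (J → S) : ℝ) * (Fintype.card S : ℝ) ^ T *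
        ((((univ : Finset (J → S)).filter InG).card : ℝ) / Fintype.card (J → S)) ^ (T + 1) *
        Real.exp (-(((((univ : Finset (J → S)).filter InG).card : ℝ)⁻¹ *
          ∑ t : Fin T, ∑ v ∈ univ.filter InG,
            ((((univ : Finset S).filter fun s => InG (Function.update v (σ t) s) ∧
                ¬ St v (Function.update v (σ t) s)).card : ℝ) + 1) /
              (((univ : Finset S).filter fun s => InG (Function.update v (σ t) s)).card : ℝ) *
              Real.log ((((univ : Finset S).filter fun s => InG (Function.update v (σ t) s) ∧
                ¬ St v (Function.update v (σ t) s)).card : ℝ) + 1))))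
      ≤ (((univ : Finset ((J → S) × (Fin T → S))).filter fun vU =>
          (∀ t : Fin (T + 1), InG (pos vU.1 vU.2 t)) ∧
            ∀ t : Fin T, St (pos vU.1 vU.2 t) (pos vU.1 vU.2 ((t : ℕ) + 1))).card : ℝ) := by
  -- opaque fibre counts `d`, `u`
  obtain ⟨d, hd⟩ : ∃ d : J → (J → S) → ℕ, ∀ j v,
      d j v = ((univ : Finset S).filter fun s => InG (Function.update v j s)).card :=
    ⟨_, fun _ _ => rfl⟩
  obtain ⟨u, hu⟩ : ∃ u : J → (J → S) → ℕ, ∀ j v, u j v = ((univ : Finset S).filter fun s =>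
      InG (Function.update v j s) ∧ ¬ St v (Function.update v j s)).card := ⟨_, fun _ _ => rfl⟩
  simp only [← hu, ← hd]
  have hmain := scc_main InG St hsymm hrefl d u hd hu T σ pos hpos0 hposS
  set N : ℝ := (Fintype.card S : ℝ) with hN
  set G : Finset (J → S) := univ.filter InG with hGdef
  set V : ℝ := (Fintype.card (J → S) : ℝ) with hV
  set Λ : ℝ := ∑ t : Fin T, ∑ v ∈ G, ((u (σ t) v : ℝ) + 1) / d (σ t) v *
    Real.log ((u (σ t) v : ℝ) + 1) with hΛ
  have hGpos : (0 : ℝ) < G.card := by exact_mod_cast hG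
  obtain ⟨v₀, hv₀⟩ := Finset.card_pos.1 hG
  have hmemG : ∀ v ∈ G, InG v := fun v hv => by
    simpa only [hGdef, mem_filter, mem_univ, true_and] using hv
  have hN0 : (0 : ℝ) < N := by rw [hN]; exact_mod_cast hS
  have hV0 : (0 : ℝ) < V := by rw [hV]; exact_mod_cast Fintype.card_pos_iff.2 ⟨v₀⟩
  have hGV : (G.card : ℝ) ≤ V := by
    rw [hV, ← Finset.card_univ]; exact_mod_cast Finset.card_le_univ G
  set p : ℝ := (G.card : ℝ) / V with hp
  have hppos : 0 < p := div_pos hGpos hV0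
  -- per-start fractions `a v`
  set a : (J → S) → ℝ := fun v => (((univ : Finset (Fin T → S)).filter fun U =>
    (∀ t : Fin (T + 1), InG (pos v U t)) ∧
      ∀ t : Fin T, St (pos v U t) (pos v U ((t : ℕ) + 1))).card : ℝ) / N ^ T with ha
  have hapos : ∀ v ∈ G, 0 < a v := fun v hv =>
    div_pos (by exact_mod_cast scc_card_pos T σ InG St hrefl pos hpos0 hposS v (hmemG v hv))
      (pow_pos hN0 T)
  have ha0 : ∀ v, 0 ≤ a v := fun v => div_nonneg (Nat.cast_nonneg _) (pow_pos hN0 T).le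
  -- the count is `N^T Σ_v a v ≥ N^T Σ_{v ∈ G} a v`
  have hcount : (((univ : Finset ((J → S) × (Fin T → S))).filter fun vU =>
      (∀ t : Fin (T + 1), InG (pos vU.1 vU.2 t)) ∧
        ∀ t : Fin T, St (pos vU.1 vU.2 t) (pos vU.1 vU.2 ((t : ℕ) + 1))).card : ℝ) =
      N ^ T * ∑ v, a v := by
    rw [Finset.card_filter, Fintype.sum_prod_type, Nat.cast_sum, Finset.mul_sum]
    refine Finset.sum_congr rfl fun v _ => ?_
    simp only [ha]
    rw [mul_div_cancel₀ _ (pow_ne_zero T hN0.ne'), Finset.card_filter, Nat.cast_sum]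
  have hsub : ∑ v ∈ G, a v ≤ ∑ v, a v := Finset.sum_le_univ_sum_of_nonneg ha0
  -- Jensen over `G`
  have hJ : ∑ v ∈ G, (G.card : ℝ)⁻¹ • Real.log (a v) ≤ Real.log (∑ v ∈ G, (G.card : ℝ)⁻¹ • a v) := by
    refine (strictConcaveOn_log_Ioi.concaveOn).le_map_sum (fun _ _ => (inv_pos.2 hGpos).le) ?_
      (fun v hv => hapos v hv)
    rw [Finset.sum_const, nsmul_eq_mul, mul_inv_cancel₀ hGpos.ne']
  simp only [smul_eq_mul, ← Finset.mul_sum] at hJ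
  -- the fibre sizes: `Σ_t Σ_{v∈G} log d ≥ T · #G · log(#G N / V)`
  have hlogd : ∀ t : Fin T, (G.card : ℝ) * Real.log (G.card * N / V) ≤
      ∑ v ∈ G, Real.log (d (σ t) v) := fun t => scc_sum_log_d_ge (σ t) InG (d (σ t)) (hd (σ t)) hG
  have hA : (T : ℝ) * ((G.card : ℝ) * Real.log (G.card * N / V)) ≤
      ∑ t : Fin T, ∑ v ∈ G, Real.log (d (σ t) v) := by
    have h := Finset.card_nsmul_le_sum (univ : Finset (Fin T)) _ _ fun t _ => hlogd t
    rwa [Finset.card_univ, Fintype.card_fin, nsmul_eq_mul] at h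
  have hsplit : ∑ t : Fin T, (∑ v ∈ G, Real.log (d (σ t) v) - (G.card : ℝ) * Real.log N -
      ∑ v ∈ G, ((u (σ t) v : ℝ) + 1) / d (σ t) v * Real.log ((u (σ t) v : ℝ) + 1)) =
      ∑ t : Fin T, ∑ v ∈ G, Real.log (d (σ t) v) - T * ((G.card : ℝ) * Real.log N) - Λ := by
    rw [hΛ, Finset.sum_sub_distrib, Finset.sum_sub_distrib, Finset.sum_const, Finset.card_univ,
      Fintype.card_fin, nsmul_eq_mul]
  have hlogp : Real.log (G.card * N / V) - Real.log N = Real.log p := by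
    rw [hp, Real.log_div (mul_pos hGpos hN0).ne' hV0.ne', Real.log_mul hGpos.ne' hN0.ne',
      Real.log_div hGpos.ne' hV0.ne']
    ring
  -- `(1/#G) Σ_G log a ≥ T log p − Λ/#G`
  have hmain' : (T : ℝ) * (G.card : ℝ) * Real.log p - Λ ≤ ∑ v ∈ G, Real.log (a v) := by
    rw [hsplit] at hmain
    simp only [ha]
    have : (T : ℝ) * (G.card : ℝ) * Real.log p =
        T * ((G.card : ℝ) * Real.log (G.card * N / V)) - T * ((G.card : ℝ) * Real.log N) := by
      rw [← hlogp]; ring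
    linarith [hmain, hA]
  have havg : (T : ℝ) * Real.log p - (G.card : ℝ)⁻¹ * Λ ≤ (G.card : ℝ)⁻¹ * ∑ v ∈ G, Real.log (a v) := by
    have h := mul_le_mul_of_nonneg_left hmain' (inv_pos.2 hGpos).le
    have h' : (G.card : ℝ)⁻¹ * ((T : ℝ) * (G.card : ℝ) * Real.log p - Λ) =
        (T : ℝ) * Real.log p - (G.card : ℝ)⁻¹ * Λ := by
      field_simp
    linarith [h, h']
  -- exponentiate
  have hsumG_pos : 0 < ∑ v ∈ G, a v := Finset.sum_pos hapos ⟨v₀, hv₀⟩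
  have hexp : Real.exp ((T : ℝ) * Real.log p - (G.card : ℝ)⁻¹ * Λ) ≤ (G.card : ℝ)⁻¹ * ∑ v ∈ G, a v := by
    have h1 : (T : ℝ) * Real.log p - (G.card : ℝ)⁻¹ * Λ ≤ Real.log ((G.card : ℝ)⁻¹ * ∑ v ∈ G, a v) :=
      havg.trans hJ
    have h2 := Real.exp_le_exp.2 h1
    rwa [Real.exp_log (mul_pos (inv_pos.2 hGpos) hsumG_pos)] at h2
  have hexp_eq : Real.exp ((T : ℝ) * Real.log p - (G.card : ℝ)⁻¹ * Λ) =
      p ^ T * Real.exp (-((G.card : ℝ)⁻¹ * Λ)) := by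
    rw [Real.exp_sub, ← Real.log_pow, Real.exp_log (pow_pos hppos T), Real.exp_neg, div_eq_mul_inv]
  rw [hexp_eq] at hexp
  -- assemble
  have hGa : (G.card : ℝ) * (p ^ T * Real.exp (-((G.card : ℝ)⁻¹ * Λ))) ≤ ∑ v ∈ G, a v := by
    have h := mul_le_mul_of_nonneg_left hexp hGpos.le
    rwa [← mul_assoc (G.card : ℝ) (G.card : ℝ)⁻¹, mul_inv_cancel₀ hGpos.ne', one_mul] at h
  have hVp : V * p = G.card := by rw [hp]; field_simp
  calc V * N ^ T * p ^ (T + 1) * Real.exp (-((G.card : ℝ)⁻¹ * Λ))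
      = N ^ T * ((V * p) * (p ^ T * Real.exp (-((G.card : ℝ)⁻¹ * Λ)))) := by ring
    _ = N ^ T * ((G.card : ℝ) * (p ^ T * Real.exp (-((G.card : ℝ)⁻¹ * Λ)))) := by rw [hVp]
    _ ≤ N ^ T * ∑ v ∈ G, a v := mul_le_mul_of_nonneg_left hGa (pow_pos hN0 T).le
    _ ≤ N ^ T * ∑ v, a v := mul_le_mul_of_nonneg_left hsub (pow_pos hN0 T).le
    _ = _ := hcount.symm

/-- **The defect bound.** `Λ(j) ≤ 2·log(2N)·√(N^{|J|}/N)·√U_j` with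
`U_j = #{(v, s) : v ∈ G, v[j↦s] ∈ G, ¬St(v, v[j↦s])}` the number of unstable good ordered pairs in
direction `j`: `(u+1) log(u+1) ≤ 2u·log(2N)`, Cauchy–Schwarz `Σ_G u/d ≤ √(Σ_G u)·√(Σ_G u/d²)`, and
`Σ_G u/d² ≤ Σ_G 1/d ≤ N^{|J|}/N`. -/
theorem scc_defect_le [Fintype S] [Fintype J] [DecidableEq S] (hS : 0 < Fintype.card S) (j : J)
    (InG : (J → S) → Prop) (St : (J → S) → (J → S) → Prop) :
    ∑ v ∈ univ.filter InG,
        ((((univ : Finset S).filter fun s => InG (Function.update v j s) ∧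
            ¬ St v (Function.update v j s)).card : ℝ) + 1) /
          (((univ : Finset S).filter fun s => InG (Function.update v j s)).card : ℝ) *
          Real.log ((((univ : Finset S).filter fun s => InG (Function.update v j s) ∧
            ¬ St v (Function.update v j s)).card : ℝ) + 1)
      ≤ 2 * Real.log (2 * Fintype.card S) * Real.sqrt (Fintype.card (J → S) / Fintype.card S) *
          Real.sqrt (((univ : Finset ((J → S) × S)).filter fun p =>
            InG p.1 ∧ (InG (Function.update p.1 j p.2) ∧
              ¬ St p.1 (Function.update p.1 j p.2))).card : ℝ) := by
  -- opaque fibre counts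
  obtain ⟨d, hd⟩ : ∃ d : (J → S) → ℕ, ∀ v,
      d v = ((univ : Finset S).filter fun s => InG (Function.update v j s)).card := ⟨_, fun _ => rfl⟩
  obtain ⟨u, hu⟩ : ∃ u : (J → S) → ℕ, ∀ v, u v = ((univ : Finset S).filter fun s =>
      InG (Function.update v j s) ∧ ¬ St v (Function.update v j s)).card := ⟨_, fun _ => rfl⟩
  -- the pair count is `Σ_{v∈G} u v`
  have hU : (((univ : Finset ((J → S) × S)).filter fun p =>
      InG p.1 ∧ (InG (Function.update p.1 j p.2) ∧ ¬ St p.1 (Function.update p.1 j p.2))).card : ℝ) =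
      ∑ v ∈ univ.filter InG, (u v : ℝ) := by
    rw [Finset.card_filter, Nat.cast_sum, Fintype.sum_prod_type, Finset.sum_filter]
    refine Finset.sum_congr rfl fun v _ => ?_
    dsimp only
    by_cases hv : InG v
    · rw [if_pos hv, hu, Finset.card_filter, Nat.cast_sum]
      refine Finset.sum_congr rfl fun s _ => ?_
      simp only [hv, true_and]
    · rw [if_neg hv]
      refine Finset.sum_eq_zero fun s _ => ?_
      rw [if_neg (fun h => hv h.1), Nat.cast_zero]
  simp only [← hu, ← hd]
  rw [hU]
  set N : ℝ := (Fintype.card S : ℝ) with hN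
  set G : Finset (J → S) := univ.filter InG with hGdef
  set V : ℝ := (Fintype.card (J → S) : ℝ) with hV
  have hmemG : ∀ v ∈ G, InG v := fun v hv => by
    simpa only [hGdef, mem_filter, mem_univ, true_and] using hv
  have hN1 : (1 : ℝ) ≤ N := by rw [hN]; exact_mod_cast hS
  have hN0 : (0 : ℝ) < N := by linarith
  have hlog0 : 0 ≤ Real.log (2 * N) := Real.log_nonneg (by linarith)
  have hud : ∀ v, u v ≤ d v := fun v => by
    rw [hu, hd]
    exact Finset.card_le_card fun s hs => by
      simp only [mem_filter, mem_univ, true_and] at hs ⊢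
      exact hs.1
  have huN : ∀ v, (u v : ℝ) ≤ N := fun v => by
    rw [hu, hN, ← Finset.card_univ]
    exact_mod_cast Finset.card_le_card (Finset.filter_subset _ _)
  have hdpos : ∀ v ∈ G, (0 : ℝ) < d v := fun v hv => by
    rw [hd]
    exact_mod_cast Finset.card_pos.2 ⟨v j, by
      simp only [mem_filter, mem_univ, true_and, Function.update_eq_self]; exact hmemG v hv⟩
  -- (1) pointwise: `(u+1)/d · log(u+1) ≤ 2 log(2N) · u/d`
  have hpt : ∀ v ∈ G, ((u v : ℝ) + 1) / d v * Real.log ((u v : ℝ) + 1) ≤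
      2 * Real.log (2 * N) * ((u v : ℝ) / d v) := by
    intro v hv
    have hd0 := hdpos v hv
    rcases Nat.eq_zero_or_pos (u v) with h0 | hpos
    · rw [h0]; simp
    · have hu1 : (1 : ℝ) ≤ u v := by exact_mod_cast hpos
      have hlog1 : Real.log ((u v : ℝ) + 1) ≤ Real.log (2 * N) :=
        Real.log_le_log (by linarith) (by linarith [huN v])
      have hlog2 : 0 ≤ Real.log ((u v : ℝ) + 1) := Real.log_nonneg (by linarith)
      have hfrac : ((u v : ℝ) + 1) / d v ≤ 2 * (u v : ℝ) / d v :=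
        div_le_div_of_nonneg_right (by linarith) hd0.le
      calc ((u v : ℝ) + 1) / d v * Real.log ((u v : ℝ) + 1)
          ≤ (2 * (u v : ℝ) / d v) * Real.log (2 * N) :=
            mul_le_mul hfrac hlog1 hlog2 (by positivity)
        _ = 2 * Real.log (2 * N) * ((u v : ℝ) / d v) := by ring
  -- (2) Cauchy–Schwarz: `Σ_G u/d ≤ √(Σ_G u) √(Σ_G u/d²)`
  have hCS : ∑ v ∈ G, (u v : ℝ) / d v ≤
      Real.sqrt (∑ v ∈ G, (u v : ℝ)) * Real.sqrt (∑ v ∈ G, (u v : ℝ) / (d v) ^ 2) := by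
    have hfg : ∀ v ∈ G, (u v : ℝ) / d v = Real.sqrt (u v) * (Real.sqrt (u v) / d v) := fun v _ => by
      rw [← mul_div_assoc, Real.mul_self_sqrt (Nat.cast_nonneg _)]
    have hf2 : ∀ v ∈ G, (u v : ℝ) = Real.sqrt (u v) ^ 2 := fun v _ => by
      rw [Real.sq_sqrt (Nat.cast_nonneg _)]
    have hg2 : ∀ v ∈ G, (u v : ℝ) / (d v) ^ 2 = (Real.sqrt (u v) / d v) ^ 2 := fun v _ => by
      rw [div_pow, Real.sq_sqrt (Nat.cast_nonneg _)]
    rw [Finset.sum_congr rfl hfg, Finset.sum_congr rfl hf2, Finset.sum_congr rfl hg2]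
    rw [← Real.sqrt_mul (Finset.sum_nonneg fun i _ => sq_nonneg _)]
    exact (le_abs_self _).trans (Real.abs_le_sqrt (Finset.sum_mul_sq_le_sq_mul_sq G _ _))
  -- (3) `Σ_G u/d² ≤ Σ_G 1/d ≤ V/N`
  have h3 : ∑ v ∈ G, (u v : ℝ) / (d v) ^ 2 ≤ V / N := by
    have hstep : ∑ v ∈ G, (u v : ℝ) / (d v) ^ 2 ≤ ∑ v ∈ G, (d v : ℝ)⁻¹ := by
      refine Finset.sum_le_sum fun v hv => ?_
      have hd0 := hdpos v hv
      have hle : (u v : ℝ) ≤ d v := by exact_mod_cast hud v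
      rw [div_le_iff₀ (pow_pos hd0 2)]
      calc (u v : ℝ) ≤ d v := hle
        _ = (d v : ℝ)⁻¹ * (d v : ℝ) ^ 2 := by field_simp
    have hinv := scc_sum_inv_d_le j InG d hd
    rw [le_div_iff₀ hN0]
    calc (∑ v ∈ G, (u v : ℝ) / (d v) ^ 2) * N ≤ (∑ v ∈ G, (d v : ℝ)⁻¹) * N :=
          mul_le_mul_of_nonneg_right hstep hN0.le
      _ = N * ∑ v ∈ G, (d v : ℝ)⁻¹ := mul_comm _ _
      _ ≤ V := hinv
  -- assemble
  have hsum := Finset.sum_le_sum hpt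
  rw [← Finset.mul_sum] at hsum
  have hsqrt : Real.sqrt (∑ v ∈ G, (u v : ℝ) / (d v) ^ 2) ≤ Real.sqrt (V / N) := Real.sqrt_le_sqrt h3
  have hU0 : 0 ≤ Real.sqrt (∑ v ∈ G, (u v : ℝ)) := Real.sqrt_nonneg _
  calc ∑ v ∈ G, ((u v : ℝ) + 1) / d v * Real.log ((u v : ℝ) + 1)
      ≤ 2 * Real.log (2 * N) * ∑ v ∈ G, (u v : ℝ) / d v := hsum
    _ ≤ 2 * Real.log (2 * N) * (Real.sqrt (∑ v ∈ G, (u v : ℝ)) * Real.sqrt (V / N)) := by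
        refine mul_le_mul_of_nonneg_left (hCS.trans ?_) (by positivity)
        exact mul_le_mul_of_nonneg_left hsqrt hU0
    _ = 2 * Real.log (2 * N) * Real.sqrt (V / N) * Real.sqrt (∑ v ∈ G, (u v : ℝ)) := by ring

/-- **Tight-path Sidorenko bound for the systematic scan** (the stability-free case of `scc_count`):
the pairs `(v, U)` whose resampling walk stays in `G` at all `T+1` times number at least
`N^{|J|} · N^T · p^{T+1}`, `p = #G/N^{|J|}` — i.e. `P[Y_0, …, Y_T ∈ G] ≥ P[G]^{T+1}` for the walk
started uniformly, whatever the (deterministic, inhomogeneous) scan order. -/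
theorem scc_count_allGood [Fintype S] [Fintype J] [DecidableEq S] (hS : 0 < Fintype.card S)
    (T : ℕ) (σ : Fin T → J) (InG : (J → S) → Prop)
    (pos : (J → S) → (Fin T → S) → ℕ → (J → S)) (hpos0 : ∀ v U, pos v U 0 = v)
    (hposS : ∀ v U (t : Fin T), pos v U ((t : ℕ) + 1) = Function.update (pos v U t) (σ t) (U t))
    (hG : 0 < ((univ : Finset (J → S)).filter InG).card) :
    (Fintype.card (J → S) : ℝ) * (Fintype.card S : ℝ) ^ T *
        ((((univ : Finset (J → S)).filter InG).card : ℝ) / Fintype.card (J → S)) ^ (T + 1)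
      ≤ (((univ : Finset ((J → S) × (Fin T → S))).filter fun vU =>
          ∀ t : Fin (T + 1), InG (pos vU.1 vU.2 t)).card : ℝ) := by
  have h := scc_count hS T σ InG (fun _ _ => True) (fun _ _ _ => trivial) (fun _ => trivial)
    pos hpos0 hposS hG
  simp only [not_true_eq_false, and_false, Finset.filter_false, Finset.card_empty, Nat.cast_zero,
    zero_add, Real.log_one, mul_zero, Finset.sum_const_zero, neg_zero, Real.exp_zero, mul_one,
    implies_true, and_true] at h
  exact h

end ScanCorrelation

end Summit.PneNP.PneNP.Theorems
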